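import Mathlib
import HarnessLib
import Summits.HubbardSuperconductivity.HubbardSuperconductivity.Theorems.KLProgrammeKLRegimeCountertermMuFlowExt
import Summits.HubbardSuperconductivity.HubbardSuperconductivity.Theorems.KLProgrammeKLRegimeCountertermPolarAngleRay
import Summits.HubbardSuperconductivity.HubbardSuperconductivity.Theorems.KLProgrammeKLRegimeCountertermGridIdentity

/-!
# Route `KLProgramme` — the Counterterm child of crux K3 (gen-2 item stmt-HubbardSuperconductivity-19664 `KLRegimeCountertermV7`,
# gen-3 twin `CountertermP2 klPredsV11 klWindowC`): READING THE RENORMALISATION CONDITION OF AN ARBITRARY FRAME THROUGH ITS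
# PARTIAL SUMS `F ⊕ Σ_{i ≤ n} ℓ_i^G(F)`, and the δμ flow read at the zone centre
# (seat hubbard-kl-k3c3-p1, technique «δμ-flow with `klAngularMean` constant piece»; part C of `…CountertermMuFlow(Ext)`)

The wholesale continuation of the repaired child (Δ18 (E3g) + Δ20 (E3a-MS); plan g10 2026-08-26 19:02Z) controls, for every Picard
iterate `F`, the TRIGONOMETRIC POLYNOMIAL `F ⊕ Σ_{i ≤ n} ℓ_i^G(F)` in the sup norm (k3c3-p2's continuation bookkeeping: `≤ tail_n +
qᵐ·d₀`).  The gate of the hypothesis block and the conclusion of `CtOneVolume` are about the PROFILE `θ ↦ ν_n(F)(θ) =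
klLocalPart … F n θ`.  This module is the bridge, for an ARBITRARY frame `F : TrigPolyC4v` and every scale `n`:

* §1 `sum_eval_klTwoLegPieceG_eq_klFrameExtG`: `Σ_{i ≤ n} ℓ_i^G(F)(q) = (klFrameExtG L μ w_n(F))(q)` at EVERY momentum `q`, where
  `w_n(F) := ν_n(F) − F∘k_F(F)` is the two-leg output proper read on the frame's curve (telescoping + the linearity of the
  G-extension, part B); the profile `w_n(F)` is `2π`-periodic and `D₄`-invariant (k3c3-p3's `…ProfileSymmetry`).
* §2 **THE READING INEQUALITY** `abs_klLocalPart_sub_partialSum_le`: at the frame's Fermi point `q_θ = klFermiPoint μ F θ`,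
  `|ν_n(F)(θ) − (F(q_θ) + Σ_{i ≤ n} ℓ_i^G(F)(q_θ))| ≤ Λ_ℓ·2π/L + Λ_w·π·(2π/L)/r` — p1b's wiggle inequality on a ray
  (`abs_eval_klFrameExtG_smul_dir_sub_le`) applied to `w_n(F)`; `Λ_ℓ` = a sup-metric Lipschitz constant of the polynomial
  `Σ_{i ≤ n} ℓ_i^G(F)` ((E3a) sizes, `j = 1`), `Λ_w` = an angular Lipschitz constant of `w_n(F)` ((E3g) + frame geometry), `r` a lower
  bound of the Fermi radius.  Corollaries: `abs_klLocalPart_le_of_partialSum` (a sup bound `B` of the partial sum gives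
  `|ν_n(F)(θ)| ≤ B + wiggle`) and `renormalisedAtF_of_partialSum` (the gate / the conclusion of the one-volume construction).
* §3 **THE δμ FLOW READ AT THE ZONE CENTRE** (this seat's technique): the angular mean of the two-leg output is the value of the
  partial sum of the pieces at `Γ = 0`, EXACTLY: `klAngularMean (w_n(F)) = Σ_{i ≤ n} ℓ_i^G(F)(0)` for `μ ≥ −3.9`
  (`klAngularMean_twoLegOutput_eq_sum_eval_zero`; the flat cutoff vanishes at `Γ`, so the G-extension reads its constant piece there),
  hence `|F(0) + m(w_n(F))| ≤ sup_q |F(q) + Σ_{i ≤ n} ℓ_i^G(F)(q)|`: at an (approximate) fixed point the counterterm's value at the zone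
  centre IS minus the chemical-potential flow `m(w_n) = m(ν_n) − m(F∘k_F)` up to the continuation's tolerance
  (`abs_eval_zero_add_klAngularMean_le_of_partialSum`).

Proofs only (no definitions, no new facts); nothing is asserted about the Hubbard model.  References: BGM 2006
[arXiv:cond-mat/0507686] §2.3–2.4 (the constant part of `δε` is the chemical-potential counterterm); FST, CPAM 53 (2000) 1350;
HOME/hubbard-kl-k3c3-p2/DEFECT-STAGE.md §1 (the node identity), HOME/hubbard-kl-k3c3-p3/DEFECT-ANGULAR.md §4.
-/

noncomputable section

namespace Summit.HubbardSuperconductivity.HubbardSuperconductivity.Theorems.KLRegimeSplit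

set_option linter.dupNamespace false -- summit = problem name (single-conjunct summit), D-0017

open Real Finset MeasureTheory
open Literature.MathematicalPhysics.QuantumLattice Literature.Probability.LatticeModels
open Literature.MathematicalPhysics.QuantumLattice.BandSectorCounting
open Summit.HubbardSuperconductivity.HubbardSuperconductivity.Theorems.KLProgrammeLegKernels
open Summit.HubbardSuperconductivity.HubbardSuperconductivity.Theorems.PerturbedFermiCurve

section Model

variable (L M : ℕ) [NeZero L] [NeZero M]

/-! ## §1 The partial sum of the G-pieces is the G-extension of the two-leg output proper -/

/-- **`Σ_{i ≤ n} ℓ_i^G(F)(q) = (klFrameExtG L μ (ν_n(F) − F∘k_F(F)))(q)` at every momentum** (telescoping of the G-pieces + linearity of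
the G-extension; the two profiles interval-integrable on `[0, 2π]` so that their angular means subtract). -/
theorem sum_eval_klTwoLegPieceG_eq_klFrameExtG (β U μ : ℝ) (F : TrigPolyC4v) (n : ℕ)
    (hν : IntervalIntegrable (klLocalPart L M β U μ F n) volume 0 (2 * π))
    (hg : IntervalIntegrable (fun θ => F.eval (klFermiPoint μ F θ)) volume 0 (2 * π)) (q : Fin 2 → ℝ) :
    ∑ i ∈ range (n + 1), (klTwoLegPieceG L M β U μ F i).eval q =
      (klFrameExtG L μ (fun θ => klLocalPart L M β U μ F n θ - F.eval (klFermiPoint μ F θ))).eval q := by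
  rw [sum_eval_klTwoLegPieceG, eval_klFrameExtG_sub L μ hν hg]
  rfl

/-- The two-leg output proper `w_n(F) = ν_n(F) − F∘k_F(F)` is `2π`-periodic. -/
theorem twoLegOutput_periodic (β U μ : ℝ) (F : TrigPolyC4v) (n : ℕ) :
    Function.Periodic (fun θ => klLocalPart L M β U μ F n θ - F.eval (klFermiPoint μ F θ)) (2 * π) := fun θ => by
  simp only [klLocalPart_periodic β U μ F n θ, klFermiPoint_periodic μ F θ]

/-- `w_n(F)(θ + π) = w_n(F)(θ)`. -/
theorem twoLegOutput_add_pi (β U μ : ℝ) (F : TrigPolyC4v) (n : ℕ) (θ : ℝ) :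
    klLocalPart L M β U μ F n (θ + π) - F.eval (klFermiPoint μ F (θ + π)) =
      klLocalPart L M β U μ F n θ - F.eval (klFermiPoint μ F θ) := by
  rw [klLocalPart_add_pi, frameOnCurve_add_pi]

/-- `w_n(F)(−θ) = w_n(F)(θ)`. -/
theorem twoLegOutput_neg (β U μ : ℝ) (F : TrigPolyC4v) (n : ℕ) (θ : ℝ) :
    klLocalPart L M β U μ F n (-θ) - F.eval (klFermiPoint μ F (-θ)) =
      klLocalPart L M β U μ F n θ - F.eval (klFermiPoint μ F θ) := by
  rw [klLocalPart_neg, frameOnCurve_neg]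

/-- `w_n(F)(π/2 − θ) = w_n(F)(θ)`. -/
theorem twoLegOutput_pi_div_two_sub (β U μ : ℝ) (F : TrigPolyC4v) (n : ℕ) (θ : ℝ) :
    klLocalPart L M β U μ F n (π / 2 - θ) - F.eval (klFermiPoint μ F (π / 2 - θ)) =
      klLocalPart L M β U μ F n θ - F.eval (klFermiPoint μ F θ) := by
  rw [klLocalPart_pi_div_two_sub, frameOnCurve_pi_div_two_sub]

/-- `w_n(F)(θ + π/2) = w_n(F)(θ)` (quarter turn, from the two reflections). -/
theorem twoLegOutput_add_pi_div_two (β U μ : ℝ) (F : TrigPolyC4v) (n : ℕ) (θ : ℝ) :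
    klLocalPart L M β U μ F n (θ + π / 2) - F.eval (klFermiPoint μ F (θ + π / 2)) =
      klLocalPart L M β U μ F n θ - F.eval (klFermiPoint μ F θ) := by
  have h := twoLegOutput_pi_div_two_sub L M β U μ F n (-θ)
  rw [show π / 2 - -θ = θ + π / 2 by ring, twoLegOutput_neg] at h
  exact h

/-! ## §2 The reading inequality: the local part at `θ` is the partial sum at the Fermi point, up to the wiggle -/

/-- **THE READING INEQUALITY.**  For every frame `F`, every scale `n` and every angle `θ` whose Fermi point `q_θ = klFermiPoint μ F θ =
u·dir θ` lies on the curve `{ε₀ = μ + F}` with `|F(q_θ)| ≤ klFlatR/2`, inside the square with seam margin `2π/L`, radius `u ≥ r > 2π/L`,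
`L ≥ 8π/klFlatR`, `μ ≤ −1/10`:
`|ν_n(F)(θ) − (F(q_θ) + Σ_{i ≤ n} ℓ_i^G(F)(q_θ))| ≤ Λ_ℓ·2π/L + Λ_w·π·(2π/L)/r`,
`Λ_ℓ` a sup-metric Lipschitz constant of the polynomial `Σ_{i ≤ n} ℓ_i^G(F)` and `Λ_w` an angular Lipschitz constant of
`w_n(F) = ν_n(F) − F∘k_F(F)`. -/
theorem abs_klLocalPart_sub_partialSum_le {μ : ℝ} (hμ : μ ≤ -(1 / 10)) (β U : ℝ) (F : TrigPolyC4v) (n : ℕ)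
    (hν : IntervalIntegrable (klLocalPart L M β U μ F n) volume 0 (2 * π))
    (hg : IntervalIntegrable (fun θ => F.eval (klFermiPoint μ F θ)) volume 0 (2 * π))
    {Λw : ℝ} (hΛw : 0 ≤ Λw)
    (hLipw : ∀ a b, |(klLocalPart L M β U μ F n a - F.eval (klFermiPoint μ F a)) -
        (klLocalPart L M β U μ F n b - F.eval (klFermiPoint μ F b))| ≤ Λw * |a - b|)
    {Λℓ : ℝ} (hΛℓ : 0 ≤ Λℓ)
    (hLipℓ : ∀ p p' : Fin 2 → ℝ, |∑ i ∈ range (n + 1), (klTwoLegPieceG L M β U μ F i).eval p -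
        ∑ i ∈ range (n + 1), (klTwoLegPieceG L M β U μ F i).eval p'| ≤ Λℓ * (|p 0 - p' 0| + |p 1 - p' 1|))
    {θ : ℝ} (hq : ∀ i, |klFermiPoint μ F θ i| ≤ π - 2 * π / L)
    (hlevel : eps2 (klFermiPoint μ F θ 0) (klFermiPoint μ F θ 1) = μ + F.eval (klFermiPoint μ F θ))
    (hsmall : |F.eval (klFermiPoint μ F θ)| ≤ klFlatR / 2) (hL : 8 * π / klFlatR ≤ L)
    {r : ℝ} (hr : 2 * π / L < r) (hru : r ≤ perturbedFermiRadius (fun p => -F.eval p) μ θ) :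
    |klLocalPart L M β U μ F n θ -
        (F.eval (klFermiPoint μ F θ) + ∑ i ∈ range (n + 1), (klTwoLegPieceG L M β U μ F i).eval (klFermiPoint μ F θ))| ≤
      Λℓ * (2 * π / L) + Λw * π * (2 * (π / L) / r) := by
  set w : ℝ → ℝ := fun θ => klLocalPart L M β U μ F n θ - F.eval (klFermiPoint μ F θ) with hw
  have hsum : ∀ q, ∑ i ∈ range (n + 1), (klTwoLegPieceG L M β U μ F i).eval q = (klFrameExtG L μ w).eval q :=
    sum_eval_klTwoLegPieceG_eq_klFrameExtG L M β U μ F n hν hg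
  have hper : Function.Periodic w (2 * π) := twoLegOutput_periodic L M β U μ F n
  have heven : ∀ θ, w (-θ) = w θ := fun θ => twoLegOutput_neg L M β U μ F n θ
  have hquart : ∀ θ, w (θ + π / 2) = w θ := fun θ => twoLegOutput_add_pi_div_two L M β U μ F n θ
  have hLipw' : ∀ a b, |w a - w b| ≤ Λw * |a - b| := fun a b => hLipw a b
  have hLipK : ∀ p p' : Fin 2 → ℝ,
      |(klFrameExtG L μ w).eval p - (klFrameExtG L μ w).eval p'| ≤ Λℓ * (|p 0 - p' 0| + |p 1 - p' 1|) := by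
    intro p p'; rw [← hsum, ← hsum]; exact hLipℓ p p'
  -- the Fermi point is the ray point `u·dir θ`
  have hkF : klFermiPoint μ F θ = perturbedFermiRadius (fun p => -F.eval p) μ θ • dir θ := rfl
  have hmain := abs_eval_klFrameExtG_smul_dir_sub_le L hμ hper heven hquart hΛw hLipw' hΛℓ hLipK
    (t := perturbedFermiRadius (fun p => -F.eval p) μ θ) (θ := θ) (fun i => by rw [← hkF]; exact hq i)
    (κ := F.eval (klFermiPoint μ F θ)) (by rw [← hkF]; exact hlevel) hsmall hL hr hru
  rw [← hkF, ← hsum] at hmain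
  have e : klLocalPart L M β U μ F n θ -
      (F.eval (klFermiPoint μ F θ) + ∑ i ∈ range (n + 1), (klTwoLegPieceG L M β U μ F i).eval (klFermiPoint μ F θ)) =
      -((∑ i ∈ range (n + 1), (klTwoLegPieceG L M β U μ F i).eval (klFermiPoint μ F θ)) - w θ) := by
    simp only [hw]; ring
  rw [e, abs_neg]
  exact hmain

/-- **Renormalisation from a sup bound of the partial sum.**  If `|F(q) + Σ_{i ≤ n} ℓ_i^G(F)(q)| ≤ B` at the Fermi point `q = q_θ`
(e.g. at every `q`: the continuation's bookkeeping), then `|ν_n(F)(θ)| ≤ B + Λ_ℓ·2π/L + Λ_w·π·(2π/L)/r`. -/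
theorem abs_klLocalPart_le_of_partialSum {μ : ℝ} (hμ : μ ≤ -(1 / 10)) (β U : ℝ) (F : TrigPolyC4v) (n : ℕ)
    (hν : IntervalIntegrable (klLocalPart L M β U μ F n) volume 0 (2 * π))
    (hg : IntervalIntegrable (fun θ => F.eval (klFermiPoint μ F θ)) volume 0 (2 * π))
    {Λw : ℝ} (hΛw : 0 ≤ Λw)
    (hLipw : ∀ a b, |(klLocalPart L M β U μ F n a - F.eval (klFermiPoint μ F a)) -
        (klLocalPart L M β U μ F n b - F.eval (klFermiPoint μ F b))| ≤ Λw * |a - b|)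
    {Λℓ : ℝ} (hΛℓ : 0 ≤ Λℓ)
    (hLipℓ : ∀ p p' : Fin 2 → ℝ, |∑ i ∈ range (n + 1), (klTwoLegPieceG L M β U μ F i).eval p -
        ∑ i ∈ range (n + 1), (klTwoLegPieceG L M β U μ F i).eval p'| ≤ Λℓ * (|p 0 - p' 0| + |p 1 - p' 1|))
    {θ : ℝ} (hq : ∀ i, |klFermiPoint μ F θ i| ≤ π - 2 * π / L)
    (hlevel : eps2 (klFermiPoint μ F θ 0) (klFermiPoint μ F θ 1) = μ + F.eval (klFermiPoint μ F θ))
    (hsmall : |F.eval (klFermiPoint μ F θ)| ≤ klFlatR / 2) (hL : 8 * π / klFlatR ≤ L)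
    {r : ℝ} (hr : 2 * π / L < r) (hru : r ≤ perturbedFermiRadius (fun p => -F.eval p) μ θ)
    {B : ℝ} (hB : |F.eval (klFermiPoint μ F θ) +
        ∑ i ∈ range (n + 1), (klTwoLegPieceG L M β U μ F i).eval (klFermiPoint μ F θ)| ≤ B) :
    |klLocalPart L M β U μ F n θ| ≤ B + (Λℓ * (2 * π / L) + Λw * π * (2 * (π / L) / r)) := by
  have h := abs_klLocalPart_sub_partialSum_le L M hμ β U F n hν hg hΛw hLipw hΛℓ hLipℓ hq hlevel hsmall hL hr hru
  have htri := abs_sub_abs_le_abs_sub (klLocalPart L M β U μ F n θ)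
    (F.eval (klFermiPoint μ F θ) + ∑ i ∈ range (n + 1), (klTwoLegPieceG L M β U μ F i).eval (klFermiPoint μ F θ))
  linarith

/-- **`RenormalisedAtF` from the partial sum** (the gate of the hypothesis block for a Picard iterate, and the conclusion of the
one-volume construction): a UNIFORM sup bound `B` of `F ⊕ Σ_{i ≤ n} ℓ_i^G(F)`, the wiggle hypotheses at every angle, and
`B + wiggle ≤ cr·|U|·Λ_n²/e₀` give `RenormalisedAtF L M β U μ F R n`. -/
theorem renormalisedAtF_of_partialSum {μ : ℝ} (hμ : μ ≤ -(1 / 10)) (β U : ℝ) (F : TrigPolyC4v) (R : RenConsts) (n : ℕ)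
    (hν : IntervalIntegrable (klLocalPart L M β U μ F n) volume 0 (2 * π))
    (hg : IntervalIntegrable (fun θ => F.eval (klFermiPoint μ F θ)) volume 0 (2 * π))
    {Λw : ℝ} (hΛw : 0 ≤ Λw)
    (hLipw : ∀ a b, |(klLocalPart L M β U μ F n a - F.eval (klFermiPoint μ F a)) -
        (klLocalPart L M β U μ F n b - F.eval (klFermiPoint μ F b))| ≤ Λw * |a - b|)
    {Λℓ : ℝ} (hΛℓ : 0 ≤ Λℓ)
    (hLipℓ : ∀ p p' : Fin 2 → ℝ, |∑ i ∈ range (n + 1), (klTwoLegPieceG L M β U μ F i).eval p -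
        ∑ i ∈ range (n + 1), (klTwoLegPieceG L M β U μ F i).eval p'| ≤ Λℓ * (|p 0 - p' 0| + |p 1 - p' 1|))
    (hq : ∀ θ, ∀ i, |klFermiPoint μ F θ i| ≤ π - 2 * π / L)
    (hlevel : ∀ θ, eps2 (klFermiPoint μ F θ 0) (klFermiPoint μ F θ 1) = μ + F.eval (klFermiPoint μ F θ))
    (hsmall : ∀ θ, |F.eval (klFermiPoint μ F θ)| ≤ klFlatR / 2) (hL : 8 * π / klFlatR ≤ L)
    {r : ℝ} (hr : 2 * π / L < r) (hru : ∀ θ, r ≤ perturbedFermiRadius (fun p => -F.eval p) μ θ)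
    {B : ℝ} (hB : ∀ q : Fin 2 → ℝ, |F.eval q + ∑ i ∈ range (n + 1), (klTwoLegPieceG L M β U μ F i).eval q| ≤ B)
    (htol : B + (Λℓ * (2 * π / L) + Λw * π * (2 * (π / L) / r)) ≤ R.cr * |U| * klScale klE0 n ^ 2 / klE0) :
    RenormalisedAtF L M β U μ F R n := fun θ =>
  (abs_klLocalPart_le_of_partialSum L M hμ β U F n hν hg hΛw hLipw hΛℓ hLipℓ (hq θ) (hlevel θ) (hsmall θ) hL hr (hru θ)
    (hB _)).trans htol

/-! ## §3 The δμ flow read at the zone centre -/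

omit [NeZero L] in
/-- The zone centre `Γ = 0` is a lattice momentum: `latticeMomentum L 0 = 0`. -/
theorem latticeMomentum_zero : latticeMomentum L (0 : TorusSite 2 L) = 0 := by
  funext i; simp [latticeMomentum]

omit [NeZero L] in
/-- At the zone centre the free band is `−4`: `nambuXi L μ 0 = −4 − μ`. -/
theorem nambuXi_zero (μ : ℝ) : nambuXi L μ (0 : TorusSite 2 L) = -4 - μ := by
  simp [nambuXi, torusBand, latticeMomentum]
  norm_num

/-- **The flat cutoff vanishes at the zone centre** for `μ ≥ −3.9` (there `|ε − μ| = 4 + μ ≥ 1/10 = 2·klFlatR`). -/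
theorem klFlatCutoff_zero_site {μ : ℝ} (hμ : -(39 / 10) ≤ μ) : klFlatCutoff L μ (0 : TorusSite 2 L) = 0 := by
  apply klFlatCutoff_eq_zero_of_le_abs
  rw [nambuXi_zero, klFlatR]
  have : (2 : ℝ) * (1 / 20) ≤ 4 + μ := by linarith
  calc (2 : ℝ) * (1 / 20) ≤ 4 + μ := this
    _ ≤ |-4 - μ| := by rw [show (-4 : ℝ) - μ = -(4 + μ) by ring, abs_neg]; exact le_abs_self _

/-- **The G-extension reads its constant piece at the zone centre**: for a `2π`-periodic `D₄`-invariant profile `f` and `μ ≥ −3.9`,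
`(klFrameExtG L μ f)(0) = klAngularMean f`. -/
theorem eval_klFrameExtG_zero_eq_klAngularMean {μ : ℝ} (hμ : -(39 / 10) ≤ μ) {f : ℝ → ℝ} (hper : Function.Periodic f (2 * π))
    (hpi : ∀ θ, f (θ + π) = f θ) (hneg : ∀ θ, f (-θ) = f θ) (hsw : ∀ θ, f (π / 2 - θ) = f θ) :
    (klFrameExtG L μ f).eval 0 = klAngularMean f := by
  rw [← latticeMomentum_zero L, eval_klFrameExtG_latticeMomentum_of_profile L hper hpi hneg hsw μ 0,
    klFlatCutoff_zero_site L hμ]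
  ring

/-- **THE δμ FLOW READ AT THE ZONE CENTRE.**  For every frame `F` and scale `n` (profiles interval-integrable, `μ ≥ −3.9`): the angular
mean of the two-leg output proper — the chemical-potential flow `m(w_n(F)) = m(ν_n(F)) − m(F∘k_F(F))` — is EXACTLY the value of the
partial sum of the G-pieces at `Γ = 0`:  `klAngularMean (w_n(F)) = Σ_{i ≤ n} ℓ_i^G(F)(0)`. -/
theorem klAngularMean_twoLegOutput_eq_sum_eval_zero {μ : ℝ} (hμ : -(39 / 10) ≤ μ) (β U : ℝ) (F : TrigPolyC4v) (n : ℕ)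
    (hν : IntervalIntegrable (klLocalPart L M β U μ F n) volume 0 (2 * π))
    (hg : IntervalIntegrable (fun θ => F.eval (klFermiPoint μ F θ)) volume 0 (2 * π)) :
    klAngularMean (fun θ => klLocalPart L M β U μ F n θ - F.eval (klFermiPoint μ F θ)) =
      ∑ i ∈ range (n + 1), (klTwoLegPieceG L M β U μ F i).eval 0 := by
  rw [sum_eval_klTwoLegPieceG_eq_klFrameExtG L M β U μ F n hν hg,
    eval_klFrameExtG_zero_eq_klAngularMean L hμ (twoLegOutput_periodic L M β U μ F n)
      (twoLegOutput_add_pi L M β U μ F n) (twoLegOutput_neg L M β U μ F n) (twoLegOutput_pi_div_two_sub L M β U μ F n)]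

/-- **The δμ flow is split off the means of the local part and of the frame on its curve**:
`m(ν_n(F)) = m(F∘k_F(F)) + Σ_{i ≤ n} ℓ_i^G(F)(0)`. -/
theorem klAngularMean_klLocalPart_eq {μ : ℝ} (hμ : -(39 / 10) ≤ μ) (β U : ℝ) (F : TrigPolyC4v) (n : ℕ)
    (hν : IntervalIntegrable (klLocalPart L M β U μ F n) volume 0 (2 * π))
    (hg : IntervalIntegrable (fun θ => F.eval (klFermiPoint μ F θ)) volume 0 (2 * π)) :
    klAngularMean (klLocalPart L M β U μ F n) =
      klAngularMean (fun θ => F.eval (klFermiPoint μ F θ)) + ∑ i ∈ range (n + 1), (klTwoLegPieceG L M β U μ F i).eval 0 := by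
  rw [← klAngularMean_twoLegOutput_eq_sum_eval_zero L M hμ β U F n hν hg, klAngularMean_sub hν hg]
  ring

/-- **The δμ increments are bounded by the sizes of the pieces**: `|Σ_{i ≤ n} ℓ_i^G(F)(0)| ≤ Σ_{i ≤ n} b i` whenever
`|ℓ_i^G(F)(q)| ≤ b i` at every momentum ((E3a-G), `j = 0`), hence `|m(w_n(F))| ≤ Σ_{i ≤ n} b i`. -/
theorem abs_klAngularMean_twoLegOutput_le {μ : ℝ} (hμ : -(39 / 10) ≤ μ) (β U : ℝ) (F : TrigPolyC4v) (n : ℕ)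
    (hν : IntervalIntegrable (klLocalPart L M β U μ F n) volume 0 (2 * π))
    (hg : IntervalIntegrable (fun θ => F.eval (klFermiPoint μ F θ)) volume 0 (2 * π)) {b : ℕ → ℝ}
    (hb : ∀ i ≤ n, ∀ q : Fin 2 → ℝ, |(klTwoLegPieceG L M β U μ F i).eval q| ≤ b i) :
    |klAngularMean (fun θ => klLocalPart L M β U μ F n θ - F.eval (klFermiPoint μ F θ))| ≤ ∑ i ∈ range (n + 1), b i := by
  rw [klAngularMean_twoLegOutput_eq_sum_eval_zero L M hμ β U F n hν hg]
  refine (abs_sum_le_sum_abs _ _).trans (sum_le_sum fun i hi => ?_)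
  exact hb i (Nat.lt_succ_iff.mp (mem_range.mp hi)) 0

/-- **The counterterm at the zone centre is minus the δμ flow, up to the continuation's tolerance**: if the partial sum
`F ⊕ Σ_{i ≤ n} ℓ_i^G(F)` is within `B` at `Γ = 0` (e.g. in the sup norm), then `|F(0) + m(w_n(F))| ≤ B` — at a fixed point of the
counterterm map the frame's value at `Γ` is `−(m(ν_n) − m(F∘k_F))`, the chemical-potential counterterm. -/
theorem abs_eval_zero_add_klAngularMean_le_of_partialSum {μ : ℝ} (hμ : -(39 / 10) ≤ μ) (β U : ℝ) (F : TrigPolyC4v) (n : ℕ)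
    (hν : IntervalIntegrable (klLocalPart L M β U μ F n) volume 0 (2 * π))
    (hg : IntervalIntegrable (fun θ => F.eval (klFermiPoint μ F θ)) volume 0 (2 * π)) {B : ℝ}
    (hB : |F.eval 0 + ∑ i ∈ range (n + 1), (klTwoLegPieceG L M β U μ F i).eval 0| ≤ B) :
    |F.eval 0 + klAngularMean (fun θ => klLocalPart L M β U μ F n θ - F.eval (klFermiPoint μ F θ))| ≤ B := by
  rwa [klAngularMean_twoLegOutput_eq_sum_eval_zero L M hμ β U F n hν hg]

end Model

end Summit.HubbardSuperconductivity.HubbardSuperconductivity.Theorems.KLRegimeSplit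

end
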